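import Mathlib.Analysis.SpecialFunctions.OrdinaryHypergeometric
import Mathlib.Analysis.SpecificLimits.Basic
import Mathlib.Topology.Algebra.InfiniteSum.NatInt
import HarnessLib

/-!
# The Gauss series of `₂F₁(-1/2, 2; 7/2; ·)` in closed form — helper file 1 for item `CardyFSpec`
(route `SAWExcursionCardy`, stmt-CriticalPhenomena-4516)

The target function of the route is `F(u) = (8/5) u ₂F₁(-1/2, 2; 7/2; u)`. The Gauss coefficients
`c_n = (-1/2)_n (2)_n / ((7/2)_n n!)` of `w = ₂F₁(-1/2, 2; 7/2; ·)` (Mathlib's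
`ordinaryHypergeometricCoefficient (-1/2) 2 (7/2) n`) are a RATIONAL FUNCTION of `n`:

  `c_n = -15 (n+1) / ((2n-1)(2n+1)(2n+3)(2n+5))`   (`coeff_eq`; `c_0 = 1`, `c_n < 0` for `n ≥ 1`),

so the two boundary sums the item needs are TELESCOPING sums with closed-form partial sums:

* `∑_{n<N} c_n = 5/8 + 15/(8(2N-1)(2N+3))` (`sum_range_coeff`), hence `∑ c_n = 5/8`
  (`hasSum_coeff`) and **`₂F₁(-1/2, 2; 7/2; 1) = 5/8`** (`hyperg_one`) — Gauss's value
  `Γ(7/2)Γ(2)/(Γ(4)Γ(3/2))` for Mathlib's `ordinaryHypergeometric`, whose value at the boundary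
  point `1` is the `tsum` of the series — i.e. `F(1) = 1`;
* `∑_{n<N} (n+1) c_n = (15/64)(3/(2N-1) + 2/(2N+1) + 3/(2N+3))` (`sum_range_succ_mul_coeff`),
  hence `∑ (n+1) c_n = 0` (`hasSum_succ_mul_coeff`), which is `F'(1⁻) = 0` and yields
  **strict monotonicity of `u ↦ u·₂F₁(-1/2,2;7/2;u)` on `[0, 1]`** (`strictMonoOn_mul_hyperg`)
  by a term-wise comparison `c_n (v^{n+1} - u^{n+1}) ≥ (n+1) c_n (v-u)` (strict at `n = 1`).

No derivatives, no Abel/Tannery limit and no Gamma function are needed for these two conjuncts.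
Sources: the hypergeometric series (Andrews–Askey–Roy 1999, Def. 2.1.5, Thm 2.2.2 for the value);
the closed form of `c_n` is elementary. No definitions.
-/

noncomputable section

open Filter Topology Finset
open scoped Nat

namespace Summit.CriticalPhenomena.SAWScalingLimit.Theorems.CardyFSpec

/-! ### The coefficients in closed form -/

/-- The parameters `(-1/2, 2; 7/2)` are not non-positive integers. [folklore] -/
theorem params_ne_neg_nat (k : ℕ) :
    (k : ℝ) ≠ -(-1 / 2 : ℝ) ∧ (k : ℝ) ≠ -(2 : ℝ) ∧ (k : ℝ) ≠ -(7 / 2 : ℝ) := by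
  have hk : (0 : ℝ) ≤ k := k.cast_nonneg
  refine ⟨fun h ↦ ?_, fun h ↦ ?_, fun h ↦ ?_⟩
  · have h2 : ((2 * k : ℕ) : ℝ) = (1 : ℕ) := by push_cast; linarith
    have h3 := Nat.cast_injective (R := ℝ) h2
    omega
  · linarith
  · linarith

/-- `c_0 = 1`. [folklore] -/
theorem coeff_zero : ordinaryHypergeometricCoefficient (-1 / 2 : ℝ) 2 (7 / 2) 0 = 1 := by
  simp [ordinaryHypergeometricCoefficient]

/-- **The coefficient recursion** `c_{n+1} = c_n (n - 1/2)(n + 2)/((n + 7/2)(n + 1))`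
(ratio of consecutive Gauss coefficients). [cite: AndrewsAskeyRoy1999, Def. 2.1.5] -/
theorem coeff_succ (n : ℕ) :
    ordinaryHypergeometricCoefficient (-1 / 2 : ℝ) 2 (7 / 2) (n + 1) =
      ordinaryHypergeometricCoefficient (-1 / 2 : ℝ) 2 (7 / 2) n *
        ((-1 / 2 + n) * (2 + n) / ((7 / 2 + n) * (n + 1))) := by
  have hP : (ascPochhammer ℝ n).eval (7 / 2 : ℝ) ≠ 0 :=
    (ascPochhammer_pos n (7 / 2 : ℝ) (by norm_num)).ne'
  have h1 : (7 / 2 + (n : ℝ)) ≠ 0 := by positivity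
  have h2 : ((n : ℝ) + 1) ≠ 0 := by positivity
  have h3 : ((n ! : ℕ) : ℝ) ≠ 0 := by positivity
  unfold ordinaryHypergeometricCoefficient
  rw [ascPochhammer_succ_eval, ascPochhammer_succ_eval, ascPochhammer_succ_eval,
    Nat.factorial_succ, Nat.cast_mul, Nat.cast_succ]
  field_simp

/-- **Closed form of the Gauss coefficients of `₂F₁(-1/2, 2; 7/2; ·)`**:
`c_n = -15(n+1)/((2n-1)(2n+1)(2n+3)(2n+5))` (induction on the recursion `coeff_succ`).
[folklore] -/
theorem coeff_eq (n : ℕ) :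
    ordinaryHypergeometricCoefficient (-1 / 2 : ℝ) 2 (7 / 2) n = -15 * ((n : ℝ) + 1) /
      ((2 * (n : ℝ) - 1) * (2 * (n : ℝ) + 1) * (2 * (n : ℝ) + 3) * (2 * (n : ℝ) + 5)) := by
  induction n with
  | zero => rw [coeff_zero]; norm_num
  | succ n ih =>
    rw [coeff_succ, ih]
    have h1 : (2 * (n : ℝ) - 1) ≠ 0 := by exact_mod_cast (show (2 * (n : ℤ) - 1) ≠ 0 by omega)
    have h2 : (2 * (n : ℝ) + 1) ≠ 0 := by positivity
    have h3 : (2 * (n : ℝ) + 3) ≠ 0 := by positivity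
    have h4 : (2 * (n : ℝ) + 5) ≠ 0 := by positivity
    have h5 : (2 * (n : ℝ) + 7) ≠ 0 := by positivity
    have h6 : (7 / 2 + (n : ℝ)) ≠ 0 := by positivity
    have h7 : ((n : ℝ) + 1) ≠ 0 := by positivity
    have e1 : (2 * ((n + 1 : ℕ) : ℝ) - 1) = 2 * n + 1 := by push_cast; ring
    have e2 : (2 * ((n + 1 : ℕ) : ℝ) + 1) = 2 * n + 3 := by push_cast; ring
    have e3 : (2 * ((n + 1 : ℕ) : ℝ) + 3) = 2 * n + 5 := by push_cast; ring
    have e4 : (2 * ((n + 1 : ℕ) : ℝ) + 5) = 2 * n + 7 := by push_cast; ring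
    have e5 : (((n + 1 : ℕ) : ℝ) + 1) = n + 2 := by push_cast; ring
    rw [e1, e2, e3, e4, e5, div_mul_div_comm, div_eq_div_iff]
    · ring
    · simp only [ne_eq, mul_eq_zero, not_or]
      exact ⟨⟨⟨⟨h1, h2⟩, h3⟩, h4⟩, h6, h7⟩
    · simp only [ne_eq, mul_eq_zero, not_or]
      exact ⟨⟨⟨h2, h3⟩, h4⟩, h5⟩

/-- The shifted closed form `c_{n+1} = -(15(n+2)/((2n+1)(2n+3)(2n+5)(2n+7)))`. [folklore] -/
theorem coeff_succ_eq (n : ℕ) :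
    ordinaryHypergeometricCoefficient (-1 / 2 : ℝ) 2 (7 / 2) (n + 1) = -(15 * ((n : ℝ) + 2) /
      ((2 * (n : ℝ) + 1) * (2 * (n : ℝ) + 3) * (2 * (n : ℝ) + 5) * (2 * (n : ℝ) + 7))) := by
  rw [coeff_eq]
  have e1 : (2 * ((n + 1 : ℕ) : ℝ) - 1) = 2 * n + 1 := by push_cast; ring
  have e2 : (2 * ((n + 1 : ℕ) : ℝ) + 1) = 2 * n + 3 := by push_cast; ring
  have e3 : (2 * ((n + 1 : ℕ) : ℝ) + 3) = 2 * n + 5 := by push_cast; ring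
  have e4 : (2 * ((n + 1 : ℕ) : ℝ) + 5) = 2 * n + 7 := by push_cast; ring
  have e5 : (((n + 1 : ℕ) : ℝ) + 1) = n + 2 := by push_cast; ring
  rw [e1, e2, e3, e4, e5]
  ring

/-- `c_{n+1} < 0`: all Gauss coefficients after the first are negative. [folklore] -/
theorem coeff_succ_neg (n : ℕ) :
    ordinaryHypergeometricCoefficient (-1 / 2 : ℝ) 2 (7 / 2) (n + 1) < 0 := by
  rw [coeff_succ_eq, neg_lt_zero]
  positivity

/-- `|c_n| ≤ 1` for every `n` (`c_0 = 1`, and `15(n+2) ≤ (2n+1)(2n+3)(2n+5)(2n+7)`). [folklore] -/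
theorem abs_coeff_le_one (n : ℕ) :
    |ordinaryHypergeometricCoefficient (-1 / 2 : ℝ) 2 (7 / 2) n| ≤ 1 := by
  rcases n with _ | n
  · rw [coeff_zero, abs_one]
  · rw [coeff_succ_eq, abs_neg, abs_of_nonneg (by positivity)]
    rw [div_le_one (by positivity)]
    have hn : (0 : ℝ) ≤ n := n.cast_nonneg
    nlinarith [hn, sq_nonneg (n : ℝ)]

/-! ### `∑ c_n = 5/8`: the value `₂F₁(-1/2, 2; 7/2; 1) = 5/8` -/

/-- **Closed-form partial sums** `∑_{n<N} c_n = 5/8 + 15/(8(2N-1)(2N+3))` (telescoping of the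
partial-fraction expansion `c_n = -(15/32)[1/(2n-1) - 1/(2n+1) - 1/(2n+3) + 1/(2n+5)]`).
[folklore] -/
theorem sum_range_coeff (N : ℕ) :
    ∑ n ∈ range N, ordinaryHypergeometricCoefficient (-1 / 2 : ℝ) 2 (7 / 2) n =
      5 / 8 + 15 / (8 * ((2 * (N : ℝ) - 1) * (2 * (N : ℝ) + 3))) := by
  induction N with
  | zero => simp only [sum_range_zero, Nat.cast_zero]; norm_num
  | succ N ih =>
    rw [sum_range_succ, ih, coeff_eq]
    have h1 : (2 * (N : ℝ) - 1) ≠ 0 := by exact_mod_cast (show (2 * (N : ℤ) - 1) ≠ 0 by omega)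
    have h2 : (2 * (N : ℝ) + 1) ≠ 0 := by positivity
    have h3 : (2 * (N : ℝ) + 3) ≠ 0 := by positivity
    have h4 : (2 * (N : ℝ) + 5) ≠ 0 := by positivity
    have h8 : (2 * ((N : ℝ) + 1) - 1) ≠ 0 := by
      have : (2 * ((N : ℝ) + 1) - 1) = 2 * (N : ℝ) + 1 := by ring
      rw [this]; exact h2
    push_cast
    field_simp
    ring

/-- `15/(8(2N+1)(2N+5)) → 0`. [folklore] -/
theorem tendsto_tail_aux :
    Tendsto (fun N : ℕ ↦ 15 / (8 * ((2 * (N : ℝ) + 1) * (2 * (N : ℝ) + 5)))) atTop (𝓝 0) := by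
  refine squeeze_zero (fun N ↦ by positivity) (fun N ↦ ?_) tendsto_one_div_add_atTop_nhds_zero_nat
  rw [div_le_div_iff₀ (by positivity) (by positivity)]
  have hN : (0 : ℝ) ≤ N := N.cast_nonneg
  nlinarith [hN, sq_nonneg (N : ℝ)]

/-- The tail `∑_{n ≥ 1} c_n = -3/8` (non-positive terms, closed-form partial sums). [folklore] -/
theorem hasSum_coeff_succ :
    HasSum (fun n ↦ ordinaryHypergeometricCoefficient (-1 / 2 : ℝ) 2 (7 / 2) (n + 1))
      (-(3 / 8 : ℝ)) := by
  have hnn : ∀ n, 0 ≤ -ordinaryHypergeometricCoefficient (-1 / 2 : ℝ) 2 (7 / 2) (n + 1) :=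
    fun n ↦ by
      have := coeff_succ_neg n
      linarith
  have h : HasSum (fun n ↦ -ordinaryHypergeometricCoefficient (-1 / 2 : ℝ) 2 (7 / 2) (n + 1))
      (3 / 8) := by
    rw [hasSum_iff_tendsto_nat_of_nonneg hnn]
    have hps : ∀ N,
        ∑ i ∈ range N, -ordinaryHypergeometricCoefficient (-1 / 2 : ℝ) 2 (7 / 2) (i + 1) =
          3 / 8 - 15 / (8 * ((2 * (N : ℝ) + 1) * (2 * (N : ℝ) + 5))) := by
      intro N
      have h := sum_range_coeff (N + 1)
      rw [sum_range_succ', coeff_zero] at h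
      rw [sum_neg_distrib]
      have e1 : (2 * ((N + 1 : ℕ) : ℝ) - 1) = 2 * (N : ℝ) + 1 := by push_cast; ring
      have e2 : (2 * ((N + 1 : ℕ) : ℝ) + 3) = 2 * (N : ℝ) + 5 := by push_cast; ring
      rw [e1, e2] at h
      linarith
    simp_rw [hps]
    have := (tendsto_const_nhds (x := (3 / 8 : ℝ))).sub tendsto_tail_aux
    rwa [sub_zero] at this
  simpa using h.neg

/-- **`∑ c_n = 5/8`**, i.e. Gauss's value `₂F₁(-1/2, 2; 7/2; 1) = Γ(7/2)Γ(2)/(Γ(4)Γ(3/2)) = 5/8`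
as a genuine (telescoping) sum. [cite: AndrewsAskeyRoy1999, Thm 2.2.2] -/
theorem hasSum_coeff :
    HasSum (fun n ↦ ordinaryHypergeometricCoefficient (-1 / 2 : ℝ) 2 (7 / 2) n) (5 / 8 : ℝ) := by
  rw [← hasSum_nat_add_iff' 1]
  rw [sum_range_one, coeff_zero, show (5 / 8 : ℝ) - 1 = -(3 / 8) by norm_num]
  exact hasSum_coeff_succ

/-- The Gauss coefficients of `₂F₁(-1/2, 2; 7/2; ·)` are summable. [folklore] -/
theorem summable_coeff :
    Summable (fun n ↦ ordinaryHypergeometricCoefficient (-1 / 2 : ℝ) 2 (7 / 2) n) :=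
  hasSum_coeff.summable

/-- … absolutely summable. [folklore] -/
theorem summable_abs_coeff :
    Summable (fun n ↦ |ordinaryHypergeometricCoefficient (-1 / 2 : ℝ) 2 (7 / 2) n|) :=
  summable_abs_iff.2 summable_coeff

/-- `₂F₁(-1/2, 2; 7/2; u) = ∑ c_n uⁿ` for every real `u` (Mathlib's definition; junk value `0`
where the series diverges). [cite: AndrewsAskeyRoy1999, Def. 2.1.5] -/
theorem hyperg_eq_tsum (u : ℝ) : ₂F₁ (-1 / 2 : ℝ) 2 (7 / 2) u =
    ∑' n, ordinaryHypergeometricCoefficient (-1 / 2 : ℝ) 2 (7 / 2) n * u ^ n := by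
  rw [ordinaryHypergeometric_eq_tsum]
  simp only [smul_eq_mul, ordinaryHypergeometricCoefficient]

/-- For `|u| ≤ 1` the series `∑ c_n uⁿ` is summable (closed unit interval INCLUDED). [folklore] -/
theorem summable_coeff_mul_pow {u : ℝ} (hu : |u| ≤ 1) :
    Summable (fun n ↦ ordinaryHypergeometricCoefficient (-1 / 2 : ℝ) 2 (7 / 2) n * u ^ n) := by
  refine Summable.of_norm_bounded summable_abs_coeff fun n ↦ ?_
  rw [Real.norm_eq_abs, abs_mul, abs_pow]
  exact mul_le_of_le_one_right (abs_nonneg _) (pow_le_one₀ (abs_nonneg u) hu)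

/-- `HasSum (c_n uⁿ) (₂F₁(-1/2, 2; 7/2; u))` for `|u| ≤ 1`.
[cite: AndrewsAskeyRoy1999, Def. 2.1.5] -/
theorem hasSum_hyperg {u : ℝ} (hu : |u| ≤ 1) :
    HasSum (fun n ↦ ordinaryHypergeometricCoefficient (-1 / 2 : ℝ) 2 (7 / 2) n * u ^ n)
      (₂F₁ (-1 / 2 : ℝ) 2 (7 / 2) u) := by
  rw [hyperg_eq_tsum]
  exact (summable_coeff_mul_pow hu).hasSum

/-- **Gauss's value `₂F₁(-1/2, 2; 7/2; 1) = 5/8`** for Mathlib's `ordinaryHypergeometric`.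
[cite: AndrewsAskeyRoy1999, Thm 2.2.2] -/
theorem hyperg_one : ₂F₁ (-1 / 2 : ℝ) 2 (7 / 2) (1 : ℝ) = 5 / 8 := by
  have h := hasSum_hyperg (u := 1) (by simp)
  simp only [one_pow, mul_one] at h
  exact h.unique hasSum_coeff

/-! ### `∑ (n+1) c_n = 0` and strict monotonicity of `u ↦ u ₂F₁(-1/2, 2; 7/2; u)` on `[0, 1]` -/

/-- **Closed-form partial sums** `∑_{n<N} (n+1) c_n = (15/64)(3/(2N-1) + 2/(2N+1) + 3/(2N+3))`.
[folklore] -/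
theorem sum_range_succ_mul_coeff (N : ℕ) :
    ∑ n ∈ range N, ((n : ℝ) + 1) * ordinaryHypergeometricCoefficient (-1 / 2 : ℝ) 2 (7 / 2) n =
      15 / 64 * (3 / (2 * (N : ℝ) - 1) + 2 / (2 * (N : ℝ) + 1) + 3 / (2 * (N : ℝ) + 3)) := by
  induction N with
  | zero => simp only [sum_range_zero, Nat.cast_zero]; norm_num
  | succ N ih =>
    rw [sum_range_succ, ih, coeff_eq]
    have h1 : (2 * (N : ℝ) - 1) ≠ 0 := by exact_mod_cast (show (2 * (N : ℤ) - 1) ≠ 0 by omega)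
    have h2 : (2 * (N : ℝ) + 1) ≠ 0 := by positivity
    have h3 : (2 * (N : ℝ) + 3) ≠ 0 := by positivity
    have h4 : (2 * (N : ℝ) + 5) ≠ 0 := by positivity
    have h8 : (2 * ((N : ℝ) + 1) - 1) ≠ 0 := by
      have : (2 * ((N : ℝ) + 1) - 1) = 2 * (N : ℝ) + 1 := by ring
      rw [this]; exact h2
    push_cast
    field_simp
    ring

/-- `(15/64)(3/(2N+1) + 2/(2N+3) + 3/(2N+5)) → 0`. [folklore] -/
theorem tendsto_tail_aux₂ :
    Tendsto (fun N : ℕ ↦ 15 / 64 * (3 / (2 * (N : ℝ) + 1) + 2 / (2 * (N : ℝ) + 3) +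
      3 / (2 * (N : ℝ) + 5))) atTop (𝓝 0) := by
  have h : ∀ k : ℝ, 0 ≤ k → Tendsto (fun N : ℕ ↦ 1 / (2 * (N : ℝ) + (k + 1))) atTop (𝓝 0) := by
    intro k hk
    refine squeeze_zero (fun N ↦ by positivity) (fun N ↦ ?_) tendsto_one_div_add_atTop_nhds_zero_nat
    rw [div_le_div_iff₀ (by positivity) (by positivity)]
    have hN : (0 : ℝ) ≤ N := N.cast_nonneg
    nlinarith
  have h1 := h 0 le_rfl
  have h3 := h 2 (by norm_num)
  have h5 := h 4 (by norm_num)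
  have := ((h1.const_mul 3).add (h3.const_mul 2)).add (h5.const_mul 3)
  have := this.const_mul (15 / 64 : ℝ)
  simp only [mul_zero, add_zero] at this
  refine this.congr fun N ↦ ?_
  norm_num
  ring

/-- The tail `∑_{n ≥ 1} (n+1) c_n = -1` (non-positive terms, closed-form partial sums). [folklore] -/
theorem hasSum_succ_mul_coeff_succ :
    HasSum (fun n ↦ (((n + 1 : ℕ) : ℝ) + 1) *
      ordinaryHypergeometricCoefficient (-1 / 2 : ℝ) 2 (7 / 2) (n + 1)) (-(1 : ℝ)) := by
  have hnn : ∀ n, 0 ≤ -((((n + 1 : ℕ) : ℝ) + 1) *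
      ordinaryHypergeometricCoefficient (-1 / 2 : ℝ) 2 (7 / 2) (n + 1)) := fun n ↦ by
    have := coeff_succ_neg n
    rw [neg_nonneg]
    exact mul_nonpos_of_nonneg_of_nonpos (by positivity) this.le
  have h : HasSum (fun n ↦ -((((n + 1 : ℕ) : ℝ) + 1) *
      ordinaryHypergeometricCoefficient (-1 / 2 : ℝ) 2 (7 / 2) (n + 1))) 1 := by
    rw [hasSum_iff_tendsto_nat_of_nonneg hnn]
    have hps : ∀ N, ∑ i ∈ range N, -((((i + 1 : ℕ) : ℝ) + 1) *
        ordinaryHypergeometricCoefficient (-1 / 2 : ℝ) 2 (7 / 2) (i + 1)) =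
        1 - 15 / 64 * (3 / (2 * (N : ℝ) + 1) + 2 / (2 * (N : ℝ) + 3) + 3 / (2 * (N : ℝ) + 5)) := by
      intro N
      have h := sum_range_succ_mul_coeff (N + 1)
      rw [sum_range_succ', coeff_zero] at h
      rw [sum_neg_distrib]
      have e1 : (2 * ((N + 1 : ℕ) : ℝ) - 1) = 2 * (N : ℝ) + 1 := by push_cast; ring
      have e2 : (2 * ((N + 1 : ℕ) : ℝ) + 1) = 2 * (N : ℝ) + 3 := by push_cast; ring
      have e3 : (2 * ((N + 1 : ℕ) : ℝ) + 3) = 2 * (N : ℝ) + 5 := by push_cast; ring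
      rw [e1, e2, e3] at h
      simp only [Nat.cast_zero, zero_add, one_mul] at h
      linarith
    simp_rw [hps]
    have := (tendsto_const_nhds (x := (1 : ℝ))).sub tendsto_tail_aux₂
    rwa [sub_zero] at this
  simpa using h.neg

/-- **`∑ (n+1) c_n = 0`** (the series of `d/du [u ₂F₁(-1/2,2;7/2;u)]` at `u = 1`: `F'(1⁻) = 0`).
[folklore] -/
theorem hasSum_succ_mul_coeff :
    HasSum (fun n : ℕ ↦ ((n : ℝ) + 1) * ordinaryHypergeometricCoefficient (-1 / 2 : ℝ) 2 (7 / 2) n)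
      0 := by
  rw [← hasSum_nat_add_iff' 1]
  rw [sum_range_one, coeff_zero, Nat.cast_zero, zero_add, one_mul,
    show (0 : ℝ) - 1 = -1 by norm_num]
  exact hasSum_succ_mul_coeff_succ

/-- `v^{m+2} - u^{m+2} < (m+2) v^{m+1} (v - u)` for `0 ≤ u < v` (strict convexity of `x^{m+2}`).
[folklore] -/
theorem pow_sub_pow_lt {u v : ℝ} (hu : 0 ≤ u) (huv : u < v) (m : ℕ) :
    v ^ (m + 2) - u ^ (m + 2) < ((m : ℝ) + 2) * v ^ (m + 1) * (v - u) := by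
  have hv : 0 < v := hu.trans_lt huv
  induction m with
  | zero => norm_num; nlinarith
  | succ m ih =>
    have hle : u ^ (m + 2) ≤ v ^ (m + 2) := pow_le_pow_left₀ hu huv.le _
    have hvp : 0 < v ^ (m + 2) := pow_pos hv _
    have e1 : v ^ (m + 1 + 2) - u ^ (m + 1 + 2) =
        v * (v ^ (m + 2) - u ^ (m + 2)) + u ^ (m + 2) * (v - u) := by ring
    have e2 : (((m + 1 : ℕ) : ℝ) + 2) * v ^ (m + 1 + 1) * (v - u) =
        v * (((m : ℝ) + 2) * v ^ (m + 1) * (v - u)) + v ^ (m + 2) * (v - u) := by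
      push_cast; ring
    rw [e1, e2]
    have h1 : v * (v ^ (m + 2) - u ^ (m + 2)) < v * (((m : ℝ) + 2) * v ^ (m + 1) * (v - u)) :=
      mul_lt_mul_of_pos_left ih hv
    have h2 : u ^ (m + 2) * (v - u) ≤ v ^ (m + 2) * (v - u) :=
      mul_le_mul_of_nonneg_right hle (by linarith)
    linarith

/-- **`u ↦ u ₂F₁(-1/2, 2; 7/2; u)` is strictly increasing on `[0, 1]`** (endpoint included):
`v w(v) - u w(u) = ∑ c_n (v^{n+1} - u^{n+1}) > (v - u) ∑ (n+1) c_n = 0`, comparing term-wise with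
`c_n < 0` (`n ≥ 1`) and `v^{n+1} - u^{n+1} < (n+1)(v-u)`. [folklore] -/
theorem strictMonoOn_mul_hyperg :
    StrictMonoOn (fun u : ℝ ↦ u * ₂F₁ (-1 / 2 : ℝ) 2 (7 / 2) u) (Set.Icc 0 1) := by
  intro u hu v hv huv
  have hu1 : |u| ≤ 1 := abs_le.2 ⟨by linarith [hu.1], hu.2⟩
  have hv1 : |v| ≤ 1 := abs_le.2 ⟨by linarith [hv.1], hv.2⟩
  have hv0 : 0 < v := hu.1.trans_lt huv
  -- `g n = c_n (v^{n+1} - u^{n+1})` sums to `v w(v) - u w(u)`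
  have hg : HasSum (fun n ↦ ordinaryHypergeometricCoefficient (-1 / 2 : ℝ) 2 (7 / 2) n *
      (v ^ (n + 1) - u ^ (n + 1)))
      (v * ₂F₁ (-1 / 2 : ℝ) 2 (7 / 2) v - u * ₂F₁ (-1 / 2 : ℝ) 2 (7 / 2) u) := by
    have h := ((hasSum_hyperg hv1).mul_left v).sub ((hasSum_hyperg hu1).mul_left u)
    refine h.congr_fun fun n ↦ ?_
    ring
  -- `f n = (n+1) c_n (v - u)` sums to `0`
  have hf : HasSum (fun n : ℕ ↦ ((n : ℝ) + 1) *
      ordinaryHypergeometricCoefficient (-1 / 2 : ℝ) 2 (7 / 2) n * (v - u)) 0 := by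
    simpa using hasSum_succ_mul_coeff.mul_right (v - u)
  have hle : ∀ n : ℕ,
      ((n : ℝ) + 1) * ordinaryHypergeometricCoefficient (-1 / 2 : ℝ) 2 (7 / 2) n * (v - u) ≤
        ordinaryHypergeometricCoefficient (-1 / 2 : ℝ) 2 (7 / 2) n *
          (v ^ (n + 1) - u ^ (n + 1)) := by
    intro n
    rcases n with _ | m
    · simp
    · have hc := coeff_succ_neg m
      have hlt := pow_sub_pow_lt hu.1 huv m
      have hvm : v ^ (m + 1) ≤ 1 := pow_le_one₀ hv0.le hv.2
      have h2 : ((m : ℝ) + 2) * v ^ (m + 1) * (v - u) ≤ ((m : ℝ) + 2) * (v - u) := by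
        have : ((m : ℝ) + 2) * v ^ (m + 1) * (v - u) =
            (((m : ℝ) + 2) * (v - u)) * v ^ (m + 1) := by ring
        rw [this]
        exact mul_le_of_le_one_right (by nlinarith) hvm
      have h3 : v ^ (m + 2) - u ^ (m + 2) ≤ ((m : ℝ) + 2) * (v - u) := (hlt.trans_le h2).le
      push_cast
      nlinarith
  have hlt1 : ((1 : ℕ) + 1 : ℝ) * ordinaryHypergeometricCoefficient (-1 / 2 : ℝ) 2 (7 / 2) 1 *
      (v - u) < ordinaryHypergeometricCoefficient (-1 / 2 : ℝ) 2 (7 / 2) 1 *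
        (v ^ (1 + 1) - u ^ (1 + 1)) := by
    have hc := coeff_succ_neg 0
    simp only [zero_add] at hc
    have hlt := pow_sub_pow_lt hu.1 huv 0
    have hvm : v ^ (0 + 1) ≤ 1 := pow_le_one₀ hv0.le hv.2
    simp only [zero_add, pow_one, Nat.cast_zero] at hlt hvm
    have h3 : v ^ 2 - u ^ 2 < 2 * (v - u) := by nlinarith
    push_cast
    nlinarith
  have := hasSum_lt hle hlt1 hf hg
  linarith

end Summit.CriticalPhenomena.SAWScalingLimit.Theorems.CardyFSpec
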